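import Literature.NumberTheory.EllipticCurves.FormalGroupChartLimitLogBaseChangeProofs
import Summits.BirchSwinnertonDyer.Rank1Residual.Additive.PadicLogImage
import HarnessLib

/-!
# Route `KimAtThreeKolyvagin` (W2), crux `KatoKuriharaPortThreeShared` (item 19560), registered stub
# `stub_fineKato` = ⟨C1⟩, clause (C1.c) = SAT₀: n1011's `padicLog` on `E(ℚ_p)` IS the limit
# logarithm of the K_w-port (bridge file)

Cell `bsd-addord`, seat `bsd-addord-w2-acc4` (gen 3); `--supports stmt-BirchSwinnertonDyer-19560`.
Theorems only (no definition, no named fact, no `sorry`); nothing is asserted about any curve; the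
crux stays OPEN.

WHAT.  The E-side of SAT₀ (kim3 KIM3-W2-C1-g11 §2.4 / KIM3-W2-C1-SIZING-g12 §1) runs in two
currencies that must meet at the bottom field `ℚ₃`: (a) the `ℚ_p`-only points side of n1011-p05
(`Additive/PadicLogImage`: `LocalLog.padicLog X : E(ℚ_p) →+ ℚ_p`, `range_padicLog…`) and kim3 g12
(`KimAtThreeFineKatoSATPoints*`: `log(E₁(ℚ₃)) = 3ℤ₃`, `log(E₀(ℚ₃)) = ℤ₃`, the step (δ)
`mem_formalFiltration_zero_of_norm_padicLog_le`), all phrased with `padicLog`; (b) the K_w-port of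
the formal-group logarithm over ANY complete valued field (this seat, Literature
`FormalGroupChartLimitLog{,Equivariance,Additive,BaseChange}Proofs`: a function `ℓ` with the
defining property (SPEC) `|ℓ(Q) − z(pʳ·Q)/pʳ| ≤ |p|^{r+1}` on `E⁽ᵖ⁾`, integral, additive,
Galois-equivariant, norm ↦ trace, base change `ℓ'(ιQ) = ι(ℓQ)`).  This file proves that on
`E₁(ℚ_p)` the two AGREE:

* `padicLog_eq_limitLog` — for a `p`-integral elliptic `X/ℚ_p`, any (SPEC)-logarithm `ℓ` on
  `E₁(ℚ_p) = FormalGroupChart.kernel ‖·‖₊ X` and `Q ∈ E₁(ℚ_p)`: `padicLog X Q = ℓ Q`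
  (`p·Q ∈ E⁽²⁾(ℚ_p)` where `padicLog = padicLimitLog`, and `ℓ(Q) = padicLimitLog(p·Q)/p` by part IV);
* `padicLog_eq_limitLog_smul_div` — for ANY `P ∈ E(ℚ_p)` and `n ≠ 0` with `n·P ∈ E₁(ℚ_p)`:
  `padicLog X P = ℓ(n·P)/n` (so on `E₀(ℚ₃)` at additive reduction, `padicLog P = ℓ(3·P)/3`, the
  `ℓ₀` of part III);
* `exists_limitLog_eq_padicLog` — packaging: a (SPEC)-logarithm on `E₁(ℚ_p)` exists and equals
  `padicLog X` there.

Consequently every `ℚ₃`-statement of (a) transfers verbatim to the `ℓ` of (b) restricted along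
`ℚ₃ ⊂ K_w` (`limitLog_map_of_val_eq`), which is what the SAT₀ assembly needs to read
`Tr_{K_w/ℚ₃}(ℓ₀ P) = ℓ₀(N P)` at the bottom through kim3's (δ).
[cite: SilvermanAEC2009, Thm. IV.6.4 and Prop. VII.6.3] [cite: Kim2022StructureSelmer, §3.2.3 and Lemma 3.10]
-/

set_option autoImplicit false
-- the Theorems namespace of a single-conjunct summit repeats the summit name by design (D-0017)
set_option linter.dupNamespace false

noncomputable section

open scoped Classical NNReal

namespace Summit.BirchSwinnertonDyer.BirchSwinnertonDyer.Theorems.KimAtThreeFineKatoLimitLogPadic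

open Literature.NumberTheory.EllipticCurves.FormalGroupChart
open Summit.BirchSwinnertonDyer.Rank1Residual.Additive.LocalLog

variable {p : ℕ} [Fact p.Prime] (X : WeierstrassCurve ℚ_[p]) [X.IsIntegral ℤ_[p]] [X.IsElliptic]
  [hV : X.IsIntegral (NormedField.valuation (K := ℚ_[p])).integer]

/-- For `Q ∈ E₁(ℚ_p)`, `p·Q ∈ E⁽²⁾(ℚ_p)` (`‖z(p·Q)‖ ≤ p⁻¹‖z(Q)‖ ≤ p⁻²`), in the tree's
`formalFiltration` currency. [cite: SilvermanAEC2009, Prop. IV.3.2 with Prop. VII.2.2] -/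
theorem p_nsmul_mem_formalFiltration_two {Q : X.toAffine.Point}
    (hQ : Q ∈ kernel NormedField.valuation X) : p • Q ∈ X.formalFiltration 2 := by
  have hQl : Q ∈ level NormedField.valuation X (NormedField.valuation (p : ℚ_[p])) := by
    rw [level_padic_eq_kernel]; exact hQ
  have hpQ : p • Q ∈ kernel NormedField.valuation X := (kernel NormedField.valuation X).nsmul_mem hQ p
  refine ⟨(mem_kernel_iff_isInReductionKernel X _).mp hpQ, ?_⟩
  have hz : NormedField.valuation (p • Q).zCoord ≤
      NormedField.valuation (p : ℚ_[p]) * NormedField.valuation Q.zCoord :=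
    val_zCoord_natCast_smul_le hQl.1 hQl.2
  have hz' : NormedField.valuation (p • Q).zCoord ≤
      NormedField.valuation (p : ℚ_[p]) * NormedField.valuation (p : ℚ_[p]) :=
    hz.trans (mul_le_mul' le_rfl hQl.2)
  rw [← zCoord_eq_formalParameter, ← coe_nnnorm, ← NormedField.valuation_apply]
  have h : ((NormedField.valuation (p • Q).zCoord : ℝ≥0) : ℝ) ≤
      ((NormedField.valuation (p : ℚ_[p]) * NormedField.valuation (p : ℚ_[p]) : ℝ≥0) : ℝ) := by
    exact_mod_cast hz'
  refine h.trans (le_of_eq ?_)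
  rw [NNReal.coe_mul, NormedField.valuation_apply, coe_nnnorm, Padic.norm_p, pow_two]

variable {X}

/-- **`padicLog = ℓ` on `E₁(ℚ_p)`**: for a `p`-integral elliptic `X/ℚ_p` and any function `ℓ` with
the defining property (SPEC) of the limit logarithm on `E₁(ℚ_p)` (`FormalGroupChartLimitLogProofs`;
existence `exists_limitLog_padic`), n1011's `padicLog X` (`Additive/PadicLogImage`: `L(N·P)/N`,
`L = padicLimitLog`) agrees with `ℓ` at every `Q ∈ E₁(ℚ_p)`.
[cite: SilvermanAEC2009, Thm. IV.6.4 and Prop. VII.6.3] -/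
theorem padicLog_eq_limitLog {ℓ : X.toAffine.Point → ℚ_[p]}
    (hℓ : ∀ Q ∈ kernel NormedField.valuation X, ∀ r : ℕ,
      NormedField.valuation (ℓ Q - ((p ^ r) • Q).zCoord / (p : ℚ_[p]) ^ r) ≤
        NormedField.valuation (p : ℚ_[p]) ^ (r + 1))
    {Q : X.toAffine.Point} (hQ : Q ∈ kernel NormedField.valuation X) :
    padicLog X Q = ℓ Q := by
  have hp0 : (p : ℚ_[p]) ≠ 0 := Nat.cast_ne_zero.mpr (Fact.out : p.Prime).ne_zero
  have h1 : padicLog X (p • Q) = (p : ℚ_[p]) * padicLog X Q := by rw [map_nsmul, nsmul_eq_mul]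
  have h2 : padicLog X (p • Q) = X.padicLimitLog (p • Q) :=
    padicLog_apply_of_mem X (p_nsmul_mem_formalFiltration_two X hQ)
  rw [limitLog_eq_padicLimitLog_smul_div hℓ hQ, ← h2, h1, mul_div_cancel_left₀ _ hp0]

/-- **`padicLog P = ℓ(n·P)/n` whenever `n·P ∈ E₁(ℚ_p)`** (`n ≠ 0`; e.g. `n = p` for `P ∈ E₀(ℚ_p)`
at additive reduction, `n = [E(ℚ_p) : E₁(ℚ_p)]` in general): the logarithm on all of `E(ℚ_p)` is
determined by `ℓ`. [cite: SilvermanAEC2009, Thm. IV.6.4 and Prop. VII.6.3] -/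
theorem padicLog_eq_limitLog_smul_div {ℓ : X.toAffine.Point → ℚ_[p]}
    (hℓ : ∀ Q ∈ kernel NormedField.valuation X, ∀ r : ℕ,
      NormedField.valuation (ℓ Q - ((p ^ r) • Q).zCoord / (p : ℚ_[p]) ^ r) ≤
        NormedField.valuation (p : ℚ_[p]) ^ (r + 1))
    {n : ℕ} (hn : n ≠ 0) {P : X.toAffine.Point} (hP : n • P ∈ kernel NormedField.valuation X) :
    padicLog X P = ℓ (n • P) / (n : ℚ_[p]) := by
  have hn0 : (n : ℚ_[p]) ≠ 0 := Nat.cast_ne_zero.mpr hn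
  rw [← padicLog_eq_limitLog hℓ hP, map_nsmul, nsmul_eq_mul, mul_div_cancel_left₀ _ hn0]

variable (X)

/-- **Packaging**: there is a (SPEC)-logarithm `ℓ` on `E₁(ℚ_p)` and it equals n1011's `padicLog X`
there — so the `ℚ_p`-side lemmas of the tree phrased with `padicLog` (`range_padicLog…`, kim3's
`KimAtThreeFineKatoSATPoints*`) are statements about the limit logarithm of the K_w-port, and
conversely its Galois-equivariance / norm-to-trace / base-change theorems apply to `padicLog`.
[cite: SilvermanAEC2009, Thm. IV.6.4 and Prop. VII.6.3] -/
theorem exists_limitLog_eq_padicLog :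
    ∃ ℓ : X.toAffine.Point → ℚ_[p],
      (∀ Q ∈ kernel NormedField.valuation X, ∀ r : ℕ,
        NormedField.valuation (ℓ Q - ((p ^ r) • Q).zCoord / (p : ℚ_[p]) ^ r) ≤
          NormedField.valuation (p : ℚ_[p]) ^ (r + 1)) ∧
      ∀ Q ∈ kernel NormedField.valuation X, ℓ Q = padicLog X Q := by
  obtain ⟨ℓ, hℓ⟩ := exists_limitLog_padic X
  exact ⟨ℓ, hℓ, fun Q hQ ↦ (padicLog_eq_limitLog hℓ hQ).symm⟩

end Summit.BirchSwinnertonDyer.BirchSwinnertonDyer.Theorems.KimAtThreeFineKatoLimitLogPadic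

end
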